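import Literature.NumberTheory.LFunctions.LinnikZeroSumFromDensity
import HarnessLib

/-!
# The sum over zeros `Σ m(ρ) x^{β−1}/max(1,|γ|)` from a log-free density bound and a zero-free region

Topic `Literature/NumberTheory/LFunctions`, sub-namespace `LinnikZeroSum`. Everything here is PROVED.

The abstract form of Thorner–Zaman (2019) Lemmas 4.5–4.6 (dyadic decomposition in the height,
Bombieri's partial summation against the log-free density estimate in each block, and the
one-variable optimisation against the classical zero-free region), for a finite family of "zeros"
`(βᵢ, γᵢ)` with weights `mᵢ ≥ 0`:

* hypotheses: `βᵢ ≤ 1 − c_Z/(𝓠 + log(|γᵢ| + 4))` (zero-free region, `𝓠 ≥ 1` playing `log Q`),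
  `Σ_{i : |γᵢ| ≤ T, α ≤ βᵢ} mᵢ ≤ D₀ · B(T)^{1−α}` for all `T ≥ 1`, `α ≤ 1` with
  `B(T) = e^{b(𝓠 + log(T + 4))}` (log-free density with exponent `b = c_D`), and the range
  `B(T₁) ≤ x^{1/2}` where all `|γᵢ| ≤ T₁`;
* conclusion (`sum_rpow_div_le_of_density_zfr`):
  `Σᵢ mᵢ x^{βᵢ−1}/max(1, |γᵢ|) ≤ 64 D₀ (e^{−c_Z L/(4𝓠)} + e^{−√(c_Z L/4)})`, `L = log x`;
* the optimisation `exp_neg_inf_le`: `e^{−(cL/(𝓠+u) + κu)} ≤ e^{−cL/(2𝓠)} + e^{−√(2κcL)}` for `u ≥ 0`.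

## References

* J. Thorner, A. Zaman, ANT 13 (2019), Lemmas 4.5, 4.6. [ThornerZaman2019]
* E. Bombieri, *Le grand crible* (1987), §6, p. 55 (partial summation against Théorème 14). [Bombieri1987GrandCrible]
-/

noncomputable section

open Finset Real

namespace Literature.NumberTheory.LFunctions.LinnikZeroSum

/-! ### The optimisation against the classical zero-free region -/

/-- **TZ Lemma 4.6 (optimisation)**: for `c, L, 𝓠, κ > 0` and `u ≥ 0`,
`exp(−(cL/(𝓠 + u) + κu)) ≤ exp(−cL/(2𝓠)) + exp(−√(2κcL))`
(`u ≤ 𝓠`: the first term; `u ≥ 𝓠`: `cL/(2u) + κu ≥ √(2κcL)`). [cite: ThornerZaman2019, Lemma 4.6] -/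
theorem exp_neg_inf_le {c L 𝓠 κ u : ℝ} (hc : 0 < c) (hL : 0 < L) (h𝓠 : 0 < 𝓠) (hκ : 0 < κ) (hu : 0 ≤ u) :
    Real.exp (-(c * L / (𝓠 + u) + κ * u)) ≤ Real.exp (-(c * L / (2 * 𝓠))) + Real.exp (-Real.sqrt (2 * κ * (c * L))) := by
  rcases le_or_gt u 𝓠 with h | h
  · have h1 : c * L / (2 * 𝓠) ≤ c * L / (𝓠 + u) := div_le_div_of_nonneg_left (by positivity) (by positivity) (by linarith)
    have hκu : 0 ≤ κ * u := by positivity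
    have : Real.exp (-(c * L / (𝓠 + u) + κ * u)) ≤ Real.exp (-(c * L / (2 * 𝓠))) := Real.exp_le_exp.2 (by linarith)
    linarith [Real.exp_pos (-Real.sqrt (2 * κ * (c * L)))]
  · have hu0 : 0 < u := by linarith
    have h1 : c * L / (2 * u) ≤ c * L / (𝓠 + u) := div_le_div_of_nonneg_left (by positivity) (by positivity) (by linarith)
    have h2 : Real.sqrt (2 * κ * (c * L)) ≤ c * L / (2 * u) + κ * u := by
      have hs := Real.sq_sqrt (by positivity : (0:ℝ) ≤ 2 * κ * (c * L))
      have hs0 := Real.sqrt_nonneg (2 * κ * (c * L))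
      rw [div_add' _ _ _ (by positivity), le_div_iff₀ (by positivity)]
      nlinarith [sq_nonneg (Real.sqrt (2 * κ * (c * L)) - 2 * κ * u)]
    have : Real.exp (-(c * L / (𝓠 + u) + κ * u)) ≤ Real.exp (-Real.sqrt (2 * κ * (c * L))) := Real.exp_le_exp.2 (by linarith)
    linarith [Real.exp_pos (-(c * L / (2 * 𝓠)))]

/-! ### The dyadic decomposition -/

/-- The dyadic block index `k(i) = ⌊log₂ ⌊max(1,|γᵢ|)⌋⌋`: `2^k ≤ max(1,|γᵢ|) < 2^{k+1}`. [folklore] -/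
theorem dyadic_mem {y : ℝ} (hy : 1 ≤ y) :
    (2 : ℝ) ^ (Nat.log 2 ⌊y⌋₊) ≤ y ∧ y < (2 : ℝ) ^ (Nat.log 2 ⌊y⌋₊ + 1) := by
  have hfl : 1 ≤ ⌊y⌋₊ := Nat.le_floor (by exact_mod_cast hy)
  have h1 : (2 : ℕ) ^ (Nat.log 2 ⌊y⌋₊) ≤ ⌊y⌋₊ := Nat.pow_log_le_self 2 (by omega)
  have h2 : ⌊y⌋₊ < 2 ^ (Nat.log 2 ⌊y⌋₊ + 1) := Nat.lt_pow_succ_log_self (by norm_num) _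
  constructor
  · calc (2 : ℝ) ^ (Nat.log 2 ⌊y⌋₊) = ((2 ^ (Nat.log 2 ⌊y⌋₊) : ℕ) : ℝ) := by push_cast; ring
      _ ≤ (⌊y⌋₊ : ℝ) := by exact_mod_cast h1
      _ ≤ y := Nat.floor_le (by linarith)
  · have h3 : (⌊y⌋₊ : ℝ) + 1 ≤ (2 : ℝ) ^ (Nat.log 2 ⌊y⌋₊ + 1) := by
      have : ⌊y⌋₊ + 1 ≤ 2 ^ (Nat.log 2 ⌊y⌋₊ + 1) := h2
      exact_mod_cast this
    linarith [Nat.lt_floor_add_one y]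

set_option maxHeartbeats 1600000 in
/-- **The sum over zeros from a log-free density bound and a zero-free region** (Thorner–Zaman
Lemmas 4.5–4.6, abstract form; the decay `1/max(1,|γ|)` is that of one integration by parts of the
test transform). For a finite family `(βᵢ, γᵢ)` with weights `mᵢ ≥ 0`, all `|γᵢ| ≤ T₁`, a zero-free
region `βᵢ ≤ 1 − c_Z/(𝓠 + log(|γᵢ| + 4))`, the density bound
`Σ_{|γᵢ| ≤ T, α ≤ βᵢ} mᵢ ≤ D₀ e^{b(𝓠 + log(T + 4))(1−α)}` (`T ≥ 1`, `α ≤ 1`) and the range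
`e^{b(𝓠 + log(2T₁ + 4))} ≤ x^{1/2}`:
`Σᵢ mᵢ x^{βᵢ−1}/max(1,|γᵢ|) ≤ 64 D₀ (e^{−c_Z L/(4𝓠)} + e^{−√(c_Z L/4)})`, `L = log x`.
[cite: ThornerZaman2019, Lemma 4.5 and Lemma 4.6] -/
theorem sum_rpow_div_le_of_density_zfr {ι : Type*} (s : Finset ι) (β γ m : ι → ℝ) {x 𝓠 c_Z b D₀ T₁ : ℝ}
    (hx : 1 < x) (h𝓠 : 1 ≤ 𝓠) (hcZ : 0 < c_Z) (hb : 0 ≤ b) (hD₀ : 0 ≤ D₀) (hT₁ : 1 ≤ T₁)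
    (hm : ∀ i ∈ s, 0 ≤ m i) (hγ : ∀ i ∈ s, |γ i| ≤ T₁)
    (hzfr : ∀ i ∈ s, β i ≤ 1 - c_Z / (𝓠 + Real.log (|γ i| + 4)))
    (hdens : ∀ T α : ℝ, 1 ≤ T → α ≤ 1 →
      ∑ i ∈ s with (|γ i| ≤ T ∧ α ≤ β i), m i ≤ D₀ * Real.exp (b * (𝓠 + Real.log (T + 4))) ^ (1 - α))
    (hrange : Real.exp (b * (𝓠 + Real.log (2 * T₁ + 4))) ≤ x ^ ((1 : ℝ) / 2)) :
    ∑ i ∈ s, m i * x ^ (β i - 1) / max 1 |γ i| ≤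
      64 * D₀ * (Real.exp (-(c_Z * Real.log x / (4 * 𝓠))) + Real.exp (-Real.sqrt (c_Z * Real.log x / 4))) := by
  classical
  have hx0 : 0 < x := by linarith
  set L : ℝ := Real.log x with hL
  have hL0 : 0 < L := Real.log_pos hx
  -- blocks
  set kf : ι → ℕ := fun i ↦ Nat.log 2 ⌊max 1 |γ i|⌋₊ with hkf
  have hblock : ∀ i, (2 : ℝ) ^ (kf i) ≤ max 1 |γ i| ∧ max 1 |γ i| < (2 : ℝ) ^ (kf i + 1) :=
    fun i ↦ dyadic_mem (le_max_left _ _)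
  rw [← Finset.sum_fiberwise_of_maps_to (g := kf) (fun i _ ↦ Finset.mem_image_of_mem kf ‹_›)]
  -- the bound for one block `j`: `≤ 2^{-j} · 2e D₀ exp(−c_Z L/(2(𝓠 + log(2^{j+1}+4))))`
  set E : ℝ := Real.exp (-(c_Z * L / (4 * 𝓠))) + Real.exp (-Real.sqrt (c_Z * L / 4)) with hE
  have hE0 : 0 ≤ E := by positivity
  have hkey : ∀ j ∈ s.image kf, ∑ i ∈ s with kf i = j, m i * x ^ (β i - 1) / max 1 |γ i| ≤
      ((1 : ℝ) / Real.sqrt 2) ^ j * (16 * D₀ * E) := by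
    intro j hj
    obtain ⟨i₀, hi₀, hi₀j⟩ := Finset.mem_image.1 hj
    set T : ℝ := (2 : ℝ) ^ (j + 1) with hT
    have hT1 : 1 ≤ T := one_le_pow₀ (by norm_num)
    have hT2 : (2 : ℝ) ^ j ≤ T₁ := by
      have := (hblock i₀).1
      rw [hi₀j] at this
      exact this.trans (max_le hT₁ (hγ i₀ hi₀))
    have hTT₁ : T ≤ 2 * T₁ := by rw [hT, pow_succ]; linarith
    set blk := s.filter (fun i ↦ kf i = j) with hblk
    have hblk_prop : ∀ i ∈ blk, i ∈ s ∧ (2 : ℝ) ^ j ≤ max 1 |γ i| ∧ max 1 |γ i| < T ∧ |γ i| ≤ T := by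
      intro i hi
      rw [hblk, Finset.mem_filter] at hi
      have h := hblock i
      rw [hi.2] at h
      exact ⟨hi.1, h.1, h.2, (le_max_right _ _).trans h.2.le⟩
    -- reduce to `2^{-j} Σ m x^{β-1}`
    have hstep1 : ∑ i ∈ blk, m i * x ^ (β i - 1) / max 1 |γ i| ≤ ((1 : ℝ) / 2) ^ j * ∑ i ∈ blk, m i * x ^ (β i - 1) := by
      rw [Finset.mul_sum]
      refine Finset.sum_le_sum fun i hi ↦ ?_
      obtain ⟨his, h1, -, -⟩ := hblk_prop i hi
      have hpos : 0 < max 1 |γ i| := lt_of_lt_of_le one_pos (le_max_left _ _)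
      have hnum : 0 ≤ m i * x ^ (β i - 1) := mul_nonneg (hm i his) (Real.rpow_nonneg hx0.le _)
      have h2j : (0 : ℝ) < (2 : ℝ) ^ j := by positivity
      calc m i * x ^ (β i - 1) / max 1 |γ i| ≤ m i * x ^ (β i - 1) / (2 : ℝ) ^ j := div_le_div_of_nonneg_left hnum h2j h1
        _ = ((1 : ℝ) / 2) ^ j * (m i * x ^ (β i - 1)) := by rw [one_div_pow]; field_simp
    -- Bombieri's partial summation on the block
    set B : ℝ := Real.exp (b * (𝓠 + Real.log (T + 4))) with hB
    have hB1 : 1 ≤ B := Real.one_le_exp (by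
      have : 0 ≤ Real.log (T + 4) := Real.log_nonneg (by linarith); positivity)
    have hBx : B ≤ x ^ ((1 : ℝ) / 2) := by
      refine le_trans (Real.exp_le_exp.2 (mul_le_mul_of_nonneg_left ?_ hb)) hrange
      have := Real.log_le_log (by linarith : 0 < T + 4) (by linarith : T + 4 ≤ 2 * T₁ + 4)
      linarith
    have hsqrt_lt : x ^ ((1 : ℝ) / 2) < x := by
      conv_rhs => rw [← Real.rpow_one x]
      exact Real.rpow_lt_rpow_of_exponent_lt hx (by norm_num)
    have hBx' : B < x := lt_of_le_of_lt hBx hsqrt_lt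
    set η : ℝ := c_Z / (𝓠 + Real.log (T + 4)) with hη
    have hlogT : 0 ≤ Real.log (T + 4) := Real.log_nonneg (by linarith)
    have hη0 : 0 < η := div_pos hcZ (by linarith)
    have hβ' : ∀ i ∈ blk, β i ≤ 1 - η := by
      intro i hi
      obtain ⟨his, -, -, hγT⟩ := hblk_prop i hi
      refine (hzfr i his).trans ?_
      rw [hη]
      have : c_Z / (𝓠 + Real.log (T + 4)) ≤ c_Z / (𝓠 + Real.log (|γ i| + 4)) :=
        div_le_div_of_nonneg_left hcZ.le (by linarith [Real.log_nonneg (by linarith [abs_nonneg (γ i)] : (1:ℝ) ≤ |γ i| + 4)])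
          (by linarith [Real.log_le_log (by linarith [abs_nonneg (γ i)]) (by linarith : |γ i| + 4 ≤ T + 4)])
      linarith
    have hdens' : ∀ α : ℝ, α ≤ 1 - η → ∑ i ∈ blk with α ≤ β i, m i ≤ D₀ * B ^ (1 - α) := by
      intro α hα
      refine le_trans ?_ (hdens T α hT1 (by linarith))
      refine Finset.sum_le_sum_of_subset_of_nonneg ?_ fun i hi _ ↦ hm i (Finset.mem_filter.1 hi).1
      intro i hi
      rw [Finset.mem_filter] at hi ⊢
      obtain ⟨his, -, -, hγT⟩ := hblk_prop i hi.1
      exact ⟨his, hγT, hi.2⟩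
    have hbomb := sum_mul_rpow_le_of_density blk β m hB1 hBx' hD₀ (fun i hi ↦ hm i (hblk_prop i hi).1) hβ' hdens'
    -- `(B/x)^η ≤ exp(−ηL/2)` and `log x/log(x/B) ≤ 2`
    have hB0 : 0 < B := by linarith
    have hratio : Real.log x / Real.log (x / B) ≤ 2 := by
      have hlogB : Real.log B ≤ L / 2 := by
        have := Real.log_le_log hB0 hBx
        rw [Real.log_rpow hx0, ← hL] at this
        linarith
      rw [Real.log_div hx0.ne' hB0.ne', ← hL, div_le_iff₀ (by linarith)]
      linarith
    have hpow : (B / x) ^ η ≤ Real.exp (-(η * L / 2)) := by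
      have h1 : B / x ≤ x ^ (-(1 : ℝ) / 2) := by
        rw [div_le_iff₀ hx0, show x ^ (-(1:ℝ) / 2) * x = x ^ ((1 : ℝ) / 2) by
          rw [← Real.rpow_add_one hx0.ne']; norm_num]
        exact hBx
      calc (B / x) ^ η ≤ (x ^ (-(1 : ℝ) / 2)) ^ η := Real.rpow_le_rpow (by positivity) h1 hη0.le
        _ = Real.exp (-(η * L / 2)) := by
            rw [← Real.rpow_mul hx0.le, Real.rpow_def_of_pos hx0, ← hL]; ring_nf
    have hblk_sum : ∑ i ∈ blk, m i * x ^ (β i - 1) ≤ 2 * Real.exp 1 * D₀ * Real.exp (-(η * L / 2)) := by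
      refine hbomb.trans ?_
      have h0 : 0 ≤ Real.exp 1 * D₀ * (B / x) ^ η := by positivity
      calc Real.exp 1 * D₀ * (B / x) ^ η * (Real.log x / Real.log (x / B))
          ≤ Real.exp 1 * D₀ * (B / x) ^ η * 2 := mul_le_mul_of_nonneg_left hratio h0
        _ ≤ Real.exp 1 * D₀ * Real.exp (-(η * L / 2)) * 2 := by
            refine mul_le_mul_of_nonneg_right (mul_le_mul_of_nonneg_left hpow (by positivity)) (by norm_num)
        _ = _ := by ring
    -- the `j`-dependence: `(1/2)^j exp(−ηL/2) ≤ (1/√2)^j · e · exp(−(c_Z L/2)/(𝓠 + u) − u/4)`, `u = j + 2`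
    have hlogT4 : Real.log (T + 4) ≤ (j : ℝ) + 2 := by
      -- `T + 4 = 2^{j+1} + 4 ≤ 3 · 2^{j+1}` and `log(3·2^{j+1}) = log 3 + (j+1) log 2 ≤ 1.1 + 0.7(j+1)`
      have h2j : (1 : ℝ) ≤ (2 : ℝ) ^ (j + 1) := one_le_pow₀ (by norm_num)
      have hT4 : T + 4 ≤ Real.exp ((j : ℝ) + 2) := by
        have he : Real.exp ((j : ℝ) + 2) = Real.exp 2 * Real.exp 1 ^ j := by
          rw [← Real.exp_nat_mul, ← Real.exp_add]; ring_nf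
        have h2e : (2 : ℝ) ≤ Real.exp 1 := by have := Real.exp_one_gt_d9; linarith
        have hpow2 : (2 : ℝ) ^ j ≤ Real.exp 1 ^ j := pow_le_pow_left₀ (by norm_num) h2e j
        have he2 : (7 : ℝ) ≤ Real.exp 2 := by
          have h1 := Real.exp_one_gt_d9
          have : Real.exp 2 = Real.exp 1 * Real.exp 1 := by rw [← Real.exp_add]; norm_num
          rw [this]; nlinarith
        rw [he, hT, pow_succ]
        have h2j0 : (1 : ℝ) ≤ (2 : ℝ) ^ j := one_le_pow₀ (by norm_num)
        nlinarith
      have := Real.log_le_log (by linarith) hT4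
      rwa [Real.log_exp] at this
    set u : ℝ := (j : ℝ) + 2 with hu
    have hu0 : 0 ≤ u := by positivity
    have hηL : Real.exp (-(η * L / 2)) ≤ Real.exp (-(c_Z / 2 * L / (𝓠 + u))) := by
      refine Real.exp_le_exp.2 ?_
      rw [hη]
      have h1 : c_Z / (𝓠 + u) ≤ c_Z / (𝓠 + Real.log (T + 4)) :=
        div_le_div_of_nonneg_left hcZ.le (by linarith) (by linarith)
      have : c_Z / 2 * L / (𝓠 + u) = (c_Z / (𝓠 + u)) * L / 2 := by ring
      rw [this]
      nlinarith
    have hhalf : ((1 : ℝ) / 2) ^ j ≤ ((1 : ℝ) / Real.sqrt 2) ^ j * (Real.exp 1 * Real.exp (-(u / 4))) := by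
      have hs0 : 0 < Real.sqrt 2 := Real.sqrt_pos.2 (by norm_num)
      have hs2 : Real.sqrt 2 ^ 2 = 2 := Real.sq_sqrt (by norm_num)
      have hsplit : ((1 : ℝ) / 2) ^ j = ((1 : ℝ) / Real.sqrt 2) ^ j * ((1 : ℝ) / Real.sqrt 2) ^ j := by
        rw [← mul_pow]; congr 1
        rw [div_mul_div_comm, one_mul, ← sq, hs2]
      rw [hsplit]
      refine mul_le_mul_of_nonneg_left ?_ (by positivity)
      -- `1/√2 ≤ exp(−1/4)` since `exp(1/4)^4 = e < 4 = (√2)^4`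
      have hq : (1 : ℝ) / Real.sqrt 2 ≤ Real.exp (-(1 / 4)) := by
        have h4 : Real.exp (1 / 4) ^ 4 = Real.exp 1 := by rw [← Real.exp_nat_mul]; norm_num
        have hs4 : Real.sqrt 2 ^ 4 = 4 := by
          rw [show (4 : ℕ) = 2 * 2 from rfl, pow_mul, hs2]; norm_num
        have hlt : Real.exp (1 / 4) ^ 4 < Real.sqrt 2 ^ 4 := by
          rw [h4, hs4]; have := Real.exp_one_lt_d9; linarith
        have hle : Real.exp (1 / 4) ≤ Real.sqrt 2 := (lt_of_pow_lt_pow_left₀ 4 hs0.le hlt).le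
        rw [Real.exp_neg, one_div]
        exact inv_anti₀ (Real.exp_pos _) hle
      calc ((1 : ℝ) / Real.sqrt 2) ^ j ≤ Real.exp (-(1 / 4)) ^ j := pow_le_pow_left₀ (by positivity) hq j
        _ = Real.exp (-(u / 4)) * Real.exp (1 / 2) := by
            rw [← Real.exp_nat_mul, ← Real.exp_add, hu]; ring_nf
        _ ≤ Real.exp 1 * Real.exp (-(u / 4)) := by
            rw [mul_comm]
            exact mul_le_mul_of_nonneg_right (Real.exp_le_exp.2 (by norm_num)) (Real.exp_pos _).le
    -- the optimisation
    have hopt := exp_neg_inf_le (c := c_Z / 2) (L := L) (𝓠 := 𝓠) (κ := 1 / 4) (u := u)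
      (by positivity) hL0 (by linarith) (by norm_num) hu0
    have hE' : Real.exp (-(c_Z / 2 * L / (2 * 𝓠))) + Real.exp (-Real.sqrt (2 * (1 / 4) * (c_Z / 2 * L))) = E := by
      rw [hE]; congr 2 <;> ring_nf
    rw [hE'] at hopt
    -- combine
    calc ∑ i ∈ blk, m i * x ^ (β i - 1) / max 1 |γ i|
        ≤ ((1 : ℝ) / 2) ^ j * ∑ i ∈ blk, m i * x ^ (β i - 1) := hstep1
      _ ≤ ((1 : ℝ) / Real.sqrt 2) ^ j * (Real.exp 1 * Real.exp (-(u / 4))) * (2 * Real.exp 1 * D₀ * Real.exp (-(c_Z / 2 * L / (𝓠 + u)))) := by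
          refine mul_le_mul hhalf (hblk_sum.trans (mul_le_mul_of_nonneg_left hηL (by positivity)))
            (Finset.sum_nonneg fun i hi ↦ mul_nonneg (hm i (hblk_prop i hi).1) (Real.rpow_nonneg hx0.le _)) (by positivity)
      _ = ((1 : ℝ) / Real.sqrt 2) ^ j * (2 * Real.exp 1 * Real.exp 1 * D₀ * (Real.exp (-(c_Z / 2 * L / (𝓠 + u))) * Real.exp (-(u / 4)))) := by ring
      _ = ((1 : ℝ) / Real.sqrt 2) ^ j * (2 * Real.exp 1 * Real.exp 1 * D₀ * Real.exp (-(c_Z / 2 * L / (𝓠 + u) + 1 / 4 * u))) := by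
          rw [← Real.exp_add]; ring_nf
      _ ≤ ((1 : ℝ) / Real.sqrt 2) ^ j * (2 * Real.exp 1 * Real.exp 1 * D₀ * E) := by
          refine mul_le_mul_of_nonneg_left (mul_le_mul_of_nonneg_left hopt (by positivity)) (by positivity)
      _ ≤ ((1 : ℝ) / Real.sqrt 2) ^ j * (16 * D₀ * E) := by
          refine mul_le_mul_of_nonneg_left ?_ (by positivity)
          have he3 : Real.exp 1 * Real.exp 1 ≤ 8 := by
            have := Real.exp_one_lt_d9; nlinarith [Real.exp_pos (1:ℝ)]
          nlinarith [mul_nonneg hD₀ hE0]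
  -- sum over the blocks: `Σ_j (1/√2)^j ≤ 4`
  refine (Finset.sum_le_sum hkey).trans ?_
  rw [← Finset.sum_mul]
  have hgeom : ∑ j ∈ s.image kf, ((1 : ℝ) / Real.sqrt 2) ^ j ≤ 4 := by
    have hs0 : 0 < Real.sqrt 2 := Real.sqrt_pos.2 (by norm_num)
    have hs2 : Real.sqrt 2 ^ 2 = 2 := Real.sq_sqrt (by norm_num)
    have hr0 : 0 ≤ (1 : ℝ) / Real.sqrt 2 := by positivity
    have hs1 : 1 < Real.sqrt 2 := by
      rw [show (1:ℝ) = Real.sqrt 1 from Real.sqrt_one.symm]; exact Real.sqrt_lt_sqrt (by norm_num) (by norm_num)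
    have hr1 : (1 : ℝ) / Real.sqrt 2 < 1 := by rw [div_lt_one hs0]; exact hs1
    have hs43 : (4 : ℝ) / 3 ≤ Real.sqrt 2 := by
      rw [show (4:ℝ)/3 = Real.sqrt ((4/3)^2) by rw [Real.sqrt_sq (by norm_num)]]
      exact Real.sqrt_le_sqrt (by norm_num)
    have hr34 : (1 : ℝ) / Real.sqrt 2 ≤ 3 / 4 := by
      rw [div_le_div_iff₀ hs0 (by norm_num)]; linarith
    refine (Literature.NumberTheory.Sieve.MontgomeryVaughan1975.sum_pow_le_of_lt_one _ hr0 hr1).trans ?_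
    rw [div_le_iff₀ (by linarith)]; linarith
  calc (∑ j ∈ s.image kf, ((1 : ℝ) / Real.sqrt 2) ^ j) * (16 * D₀ * E) ≤ 4 * (16 * D₀ * E) :=
        mul_le_mul_of_nonneg_right hgeom (by positivity)
    _ = 64 * D₀ * E := by ring

end Literature.NumberTheory.LFunctions.LinnikZeroSum

end
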